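import Literature.AlgebraicGeometry.Motives.VarietiesProofs
import Literature.AlgebraicGeometry.Motives.VarietiesProjectiveSpaceProofs
import Literature.AlgebraicGeometry.Motives.CyclesDimensionProofs
import Literature.AlgebraicGeometry.Motives.ProjectiveSpaceLinearSubst
import Literature.RingTheory.MvPolynomial.Directrix
import Literature.RingTheory.MvPolynomial.VariableIdeals
import HarnessLib

/-!
# Linear subspaces of `ℙᴺ_k` as points of the scheme: generic points and their dimension

For a field `k` (any characteristic, not necessarily algebraically closed) and
`ℙᴺ_k = Proj k[x₀, …, x_N]` (the tree's `projectiveSpace N k`; its points are the relevant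
homogeneous primes, ordered by SPECIALISATION `a ≤ b ↔ b ⤳ a`, i.e. by reverse inclusion,
`projectiveSpace_le_iff`), this file produces the generic points of linear subspaces and computes
their dimension in the sense used by the tree's cycle groups (`Order.height` of a point =
`dim` of its closure, `Motives/Cycles`):

* `coordSubspacePoint s` (`s ⊊ {0, …, N}`) — the point `(xᵢ : i ∈ s)` (prime by
  `Literature.RingTheory.MvPolynomial.isPrime_span_X_image`, relevant since it misses a
  variable), with `closure = V₊(xᵢ : i ∈ s)` (`closure_coordSubspacePoint`) and
  **`height = N - |s|`, `coheight = |s|`** (`height_coordSubspacePoint`): removing / adding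
  equations one at a time gives chains of the right lengths above / below it, and
  `height + coheight = N` holds at every point of the smooth irreducible `N`-fold `ℙᴺ_k`
  (`height_add_coheight_eq_of_smoothOfRelativeDimension` of `Motives/CyclesDimensionProofs` with
  `isSmoothProjective_projectiveSpace_holds`).
* `substPointEquiv`, `substPointOrderIso` — an invertible linear substitution `xⱼ ↦ τⱼ` acts on
  the points by `𝔭 ↦ σ_τ⁻¹(𝔭)` (Mathlib `ProjectiveSpectrum.comapFun` of the graded endomorphism
  `ProjectiveSpace.substGraded` of `Motives/ProjectiveSpaceLinearSubst`), an automorphism of the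
  specialisation order, hence preserving `height` and `coheight` (this is the action on points of
  the projective linear transformation `Proj.map σ_τ`, Hartshorne II Example 7.1.1; only the
  order-theoretic shadow is needed here).
* `exists_point_of_linearIndependent` — **for `t ≤ N` linearly independent linear forms
  `L₁, …, L_t` there is a point `ℓ` of `ℙᴺ_k` with homogeneous prime `(L₁, …, L_t)`,
  `height ℓ = N - t` and `coheight ℓ = t`**: a basis of `kᴺ⁺¹` adapted to the span of the `Lⱼ`
  (`Literature.RingTheory.MvPolynomial.exists_basis_adapted`) gives a coordinate change
  (`coordChangeEquiv`) carrying `(L₁, …, L_t)` to a coordinate ideal `(xⱼ : j ∈ J)`, `|J| = t`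
  (`comap_coordChange_span_X_image`). Hartshorne I Ex. 2.11: a linear variety cut out by `t`
  independent linear forms has dimension `N - t`.

The sequel `Motives/LinesInProjectiveSpace` packages the generic point `linearSubspacePoint L`
and derives the facts about LINES (`t = N - 1`: height `1`, all other points closed) and about
the line points `IsLinePoint` of embedded schemes used by `Motives/LinesGenerateChowOne`
(Tian–Zong 2014) and the route `HodgeConjecture/schlafli-minus-five`.

What is NOT here: the scheme structure `V₊(L) ≅ ℙᴺ⁻ᵗ` (Mathlib has `Proj.map` but no closed
immersions `Proj` of a graded quotient), degrees, and Fano schemes (see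
`Motives/FanoSchemeOfLines` for `F₁(X)` and its field-valued points).

## References

* [Hartshorne1977] R. Hartshorne, *Algebraic Geometry*, GTM 52 (1977): I Ex. 2.11 (linear
  varieties in `ℙⁿ`), I Prop. 1.10, II Prop. 2.5 (points and closed sets of `Proj S`),
  II Example 7.1.1 (automorphisms of `ℙⁿ_k` from linear changes of coordinates).
-/

noncomputable section

open CategoryTheory AlgebraicGeometry Order Literature.RingTheory.MvPolynomial

universe u

namespace Literature.AlgebraicGeometry.Motives

/-! ### Coordinate linear subspaces `V₊(xᵢ : i ∈ s)` of `ℙᴺ_k` as points of the scheme -/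

section CoordinateSubspaces

open _root_.MvPolynomial

variable {k : Type u} [Field k] {N : ℕ}

attribute [local instance] MvPolynomial.gradedAlgebra

local notation "𝓐" => MvPolynomial.homogeneousSubmodule (Fin (N + 1)) k

/-- The variables are forms of degree `1`. [folklore] -/
theorem X_mem_homogeneousSubmodule_one (i : Fin (N + 1)) :
    (X i : MvPolynomial (Fin (N + 1)) k) ∈ homogeneousSubmodule (Fin (N + 1)) k 1 :=
  (mem_homogeneousSubmodule _ _).mpr (isHomogeneous_X k i)

/-- The ideal `(xᵢ : i ∈ s)` is homogeneous. [folklore] -/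
theorem isHomogeneous_span_X_image (s : Set (Fin (N + 1))) :
    (Ideal.span (X '' s : Set (MvPolynomial (Fin (N + 1)) k))).IsHomogeneous 𝓐 :=
  Ideal.homogeneous_span _ _ (by
    rintro _ ⟨i, -, rfl⟩
    exact ⟨1, X_mem_homogeneousSubmodule_one i⟩)

/-- A proper subset of the variables misses a variable. [folklore] -/
theorem exists_not_mem_of_ne_univ {s : Finset (Fin (N + 1))} (hs : s ≠ Finset.univ) :
    ∃ j, j ∉ s := by
  by_contra hall
  push Not at hall
  exact hs (Finset.eq_univ_iff_forall.mpr hall)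

/-- **The generic point of the coordinate linear subspace `V₊(xᵢ : i ∈ s) ⊆ ℙᴺ_k`** for a
proper subset `s` of the homogeneous coordinates: the relevant homogeneous prime ideal
`(xᵢ : i ∈ s) ⊂ k[x₀, …, x_N]` (prime by `isPrime_span_X_image`; relevant because it misses a
variable), as a point of the scheme `ℙᴺ_k = Proj k[x₀, …, x_N]` (Hartshorne II.2: the points of
`Proj S` are the relevant homogeneous primes; I Ex. 2.11: linear varieties in `ℙⁿ`).
[cite: Hartshorne1977, I Ex. 2.11 and II Prop. 2.5] -/
def coordSubspacePoint (s : Finset (Fin (N + 1))) (hs : s ≠ Finset.univ) :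
    ↥(projectiveSpace N k).left :=
  (⟨⟨Ideal.span (X '' (s : Set (Fin (N + 1)))), isHomogeneous_span_X_image _⟩,
    isPrime_span_X_image _, fun h ↦ by
      obtain ⟨j, hj⟩ := exists_not_mem_of_ne_univ hs
      have hXj : (X j : MvPolynomial (Fin (N + 1)) k) ∈ HomogeneousIdeal.irrelevant 𝓐 :=
        HomogeneousIdeal.mem_irrelevant_of_mem _ zero_lt_one (X_mem_homogeneousSubmodule_one j)
      have hXj' : (X j : MvPolynomial (Fin (N + 1)) k) ∈
          Ideal.span (X '' (s : Set (Fin (N + 1))) : Set (MvPolynomial (Fin (N + 1)) k)) :=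
        h hXj
      exact hj (Finset.mem_coe.mp (X_mem_span_X_image_iff.mp hXj'))⟩ :
    ProjectiveSpectrum 𝓐)

/-- The homogeneous ideal of `coordSubspacePoint s` is `(xᵢ : i ∈ s)` (`rfl`). [folklore] -/
theorem toIdeal_coordSubspacePoint (s : Finset (Fin (N + 1))) (hs : s ≠ Finset.univ) :
    (ProjectiveSpectrum.asHomogeneousIdeal (𝒜 := 𝓐) (coordSubspacePoint (k := k) s hs)).toIdeal =
      Ideal.span (X '' (s : Set (Fin (N + 1)))) :=
  rfl

/-- The specialisation order of `ℙᴺ_k` (`a ≤ b ↔ b ⤳ a`) is reverse inclusion of the relevant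
homogeneous primes (`Proj.le_iff_asHomogeneousIdeal_le` of `Motives/VarietiesProofs`, restated
for the syntactic form `(projectiveSpace N k).left` of `Proj`). [folklore] -/
theorem projectiveSpace_le_iff {a b : ↥(projectiveSpace N k).left} :
    a ≤ b ↔ ProjectiveSpectrum.asHomogeneousIdeal (𝒜 := 𝓐) b ≤
      ProjectiveSpectrum.asHomogeneousIdeal (𝒜 := 𝓐) a :=
  Proj.le_iff_asHomogeneousIdeal_le _

/-- In the specialisation order of `ℙᴺ_k` (`a ≤ b ↔ b ⤳ a`, reverse inclusion of homogeneous
primes), `coordSubspacePoint s ≤ coordSubspacePoint s' ↔ s' ⊆ s`: more equations, smaller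
subspace. [folklore] -/
theorem coordSubspacePoint_le_iff {s s' : Finset (Fin (N + 1))} (hs : s ≠ Finset.univ)
    (hs' : s' ≠ Finset.univ) :
    coordSubspacePoint (k := k) s hs ≤ coordSubspacePoint s' hs' ↔ s' ⊆ s := by
  rw [projectiveSpace_le_iff]
  change Ideal.span (X '' (s' : Set (Fin (N + 1))) : Set (MvPolynomial (Fin (N + 1)) k)) ≤
    Ideal.span (X '' (s : Set (Fin (N + 1)))) ↔ _
  rw [span_X_image_le_iff, Finset.coe_subset]

/-- Strictly more equations give a strictly smaller point. [folklore] -/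
theorem coordSubspacePoint_lt {s s' : Finset (Fin (N + 1))} (hs : s ≠ Finset.univ)
    (hs' : s' ≠ Finset.univ) (h : s' ⊂ s) :
    coordSubspacePoint (k := k) s hs < coordSubspacePoint s' hs' := by
  rw [lt_iff_le_not_ge, coordSubspacePoint_le_iff, coordSubspacePoint_le_iff]
  exact ssubset_iff_subset_not_subset.mp h

/-- `coheight (coordSubspacePoint s) ≥ |s|`: removing the equations one at a time gives a chain of
`|s|` points above it. [folklore] -/
theorem card_le_coheight_coordSubspacePoint (s : Finset (Fin (N + 1))) (hs : s ≠ Finset.univ) :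
    (s.card : ℕ∞) ≤ coheight (coordSubspacePoint (k := k) s hs) := by
  suffices H : ∀ (n : ℕ) (s : Finset (Fin (N + 1))) (hs : s ≠ Finset.univ), s.card = n →
      (n : ℕ∞) ≤ coheight (coordSubspacePoint (k := k) s hs) from H _ s hs rfl
  intro n
  induction n with
  | zero => intro s hs _; simp
  | succ n ih =>
    intro s hs hcard
    obtain ⟨a, ha⟩ : s.Nonempty := Finset.card_pos.mp (by omega)
    have hs' : s.erase a ≠ Finset.univ := fun h ↦
      (Finset.notMem_erase a s) (h ▸ Finset.mem_univ a)
    have hlt := coordSubspacePoint_lt (k := k) hs hs' (Finset.erase_ssubset ha)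
    calc ((n + 1 : ℕ) : ℕ∞) = (n : ℕ∞) + 1 := by push_cast; rfl
      _ ≤ coheight (coordSubspacePoint (k := k) (s.erase a) hs') + 1 := by
          gcongr
          exact ih _ hs' (by rw [Finset.card_erase_of_mem ha, hcard]; rfl)
      _ ≤ coheight (coordSubspacePoint (k := k) s hs) := coheight_add_one_le hlt

/-- `height (coordSubspacePoint s) ≥ N - |s|`: adding equations one at a time (keeping a variable
out) gives a chain of `N - |s|` points below it. [folklore] -/
theorem sub_card_le_height_coordSubspacePoint (s : Finset (Fin (N + 1)))
    (hs : s ≠ Finset.univ) :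
    ((N - s.card : ℕ) : ℕ∞) ≤ height (coordSubspacePoint (k := k) s hs) := by
  suffices H : ∀ (m : ℕ) (s : Finset (Fin (N + 1))) (hs : s ≠ Finset.univ), N - s.card = m →
      (m : ℕ∞) ≤ height (coordSubspacePoint (k := k) s hs) from H _ s hs rfl
  intro m
  induction m with
  | zero => intro s hs _; simp
  | succ m ih =>
    intro s hs hm
    obtain ⟨a, ha⟩ := exists_not_mem_of_ne_univ hs
    have hcard : (insert a s).card = s.card + 1 := Finset.card_insert_of_notMem ha
    have ht : insert a s ≠ Finset.univ := by
      intro h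
      have h1 : (insert a s).card = N + 1 := by rw [h, Finset.card_univ, Fintype.card_fin]
      omega
    have hlt := coordSubspacePoint_lt (k := k) ht hs (Finset.ssubset_insert ha)
    calc ((m + 1 : ℕ) : ℕ∞) = (m : ℕ∞) + 1 := by push_cast; rfl
      _ ≤ height (coordSubspacePoint (k := k) (insert a s) ht) + 1 := by
          gcongr
          exact ih _ ht (by rw [hcard]; omega)
      _ ≤ height (coordSubspacePoint (k := k) s hs) := height_add_one_le hlt

/-- `ℙᴺ_k` is irreducible. [folklore] -/
theorem irreducibleSpace_projectiveSpace : IrreducibleSpace ↥(projectiveSpace N k).left :=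
  haveI := (isSmoothProjective_projectiveSpace_holds k N).geometricallyIrreducible
  GeometricallyIrreducible.irreducibleSpace_of_subsingleton (projectiveSpace N k).hom

/-- **Dimension and codimension of coordinate linear subspaces.** For a proper subset `s` of the
homogeneous coordinates of `ℙᴺ_k`, the generic point of `V₊(xᵢ : i ∈ s)` has dimension
`height = N - |s|` and codimension `coheight = |s|`: the two chains above give the lower bounds,
and `height + coheight = N` on the smooth irreducible `N`-fold `ℙᴺ_k`
(`height_add_coheight_eq_of_smoothOfRelativeDimension`). Hartshorne I Ex. 2.11 (a linear
variety cut out by `r` independent linear forms has dimension `N - r`).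
[cite: Hartshorne1977, I Ex. 2.11] -/
theorem height_coordSubspacePoint (s : Finset (Fin (N + 1))) (hs : s ≠ Finset.univ) :
    height (coordSubspacePoint (k := k) s hs) = ((N - s.card : ℕ) : ℕ∞) ∧
      coheight (coordSubspacePoint (k := k) s hs) = (s.card : ℕ∞) := by
  haveI := (isSmoothProjective_projectiveSpace_holds k N).smoothOfRelativeDimension
  haveI : IrreducibleSpace ↥(projectiveSpace N k).left := irreducibleSpace_projectiveSpace
  set P := coordSubspacePoint (k := k) s hs
  have hsum : height P + coheight P = N :=
    height_add_coheight_eq_of_smoothOfRelativeDimension (projectiveSpace N k).hom N P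
  have hh := sub_card_le_height_coordSubspacePoint (k := k) s hs
  have hc := card_le_coheight_coordSubspacePoint (k := k) s hs
  have hsN : s.card ≤ N := by
    have h1 : s.card < (Finset.univ : Finset (Fin (N + 1))).card :=
      Finset.card_lt_card (Finset.ssubset_univ_iff.mpr hs)
    rw [Finset.card_univ, Fintype.card_fin] at h1
    omega
  have hfin : height P ≠ ⊤ := by
    intro h
    rw [h, top_add] at hsum
    exact (ENat.coe_ne_top N) hsum.symm
  have hfin' : coheight P ≠ ⊤ := by
    intro h
    rw [h, add_top] at hsum
    exact (ENat.coe_ne_top N) hsum.symm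
  obtain ⟨a, ha⟩ := ENat.ne_top_iff_exists.mp hfin
  obtain ⟨b, hb⟩ := ENat.ne_top_iff_exists.mp hfin'
  rw [← ha, ← hb] at hsum ⊢
  rw [← ha] at hh
  rw [← hb] at hc
  have h1 : a + b = N := by exact_mod_cast hsum
  have h2 : N - s.card ≤ a := by exact_mod_cast hh
  have h3 : s.card ≤ b := by exact_mod_cast hc
  constructor
  · congr 1; omega
  · congr 1; omega

/-- The closure of the generic point of `V₊(xᵢ : i ∈ s)` is `V₊(xᵢ : i ∈ s)` (Hartshorne II
Prop. 2.5, proof: closed subsets of `Proj S` are the `V(𝔞)`; Mathlib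
`ProjectiveSpectrum.zeroLocus_vanishingIdeal_eq_closure`). [cite: Hartshorne1977, II Prop. 2.5] -/
theorem closure_coordSubspacePoint (s : Finset (Fin (N + 1))) (hs : s ≠ Finset.univ) :
    closure {coordSubspacePoint (k := k) s hs} =
      ProjectiveSpectrum.zeroLocus 𝓐 (X '' (s : Set (Fin (N + 1)))) := by
  set P : ProjectiveSpectrum 𝓐 := coordSubspacePoint (k := k) s hs with hP
  have key : closure ({P} : Set (ProjectiveSpectrum 𝓐)) =
      ProjectiveSpectrum.zeroLocus 𝓐 (X '' (s : Set (Fin (N + 1)))) := by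
    ext z
    rw [← ProjectiveSpectrum.le_iff_mem_closure, ← ProjectiveSpectrum.as_ideal_le_as_ideal,
      ProjectiveSpectrum.mem_zeroLocus]
    exact Ideal.span_le
  exact key

end CoordinateSubspaces

/-! ### Invertible linear substitutions act on the points of `ℙᴺ_k` by an order isomorphism -/

section LinearChange

open _root_.MvPolynomial

variable {k : Type u} [Field k] {N : ℕ}

attribute [local instance] MvPolynomial.gradedAlgebra

local notation "𝓐" => MvPolynomial.homogeneousSubmodule (Fin (N + 1)) k

variable (τ : Fin (N + 1) → MvPolynomial (Fin (N + 1)) k) (hτ : ∀ j, (τ j).IsHomogeneous 1)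
  (τ' : Fin (N + 1) → MvPolynomial (Fin (N + 1)) k) (hτ' : ∀ j, (τ' j).IsHomogeneous 1)
  (hinv : ∀ p, aeval τ (aeval τ' p) = p) (hinv' : ∀ p, aeval τ' (aeval τ p) = p)

/-- **The action of an invertible linear substitution `xⱼ ↦ τⱼ` on the points of `ℙᴺ_k`**,
`𝔭 ↦ σ_τ⁻¹(𝔭)` on relevant homogeneous primes (Mathlib `ProjectiveSpectrum.comapFun` of the
graded endomorphism `ProjectiveSpace.substGraded τ` of `Motives/ProjectiveSpaceLinearSubst`; this is
the map on points underlying the projective linear transformation `Proj.map σ_τ`,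
Hartshorne II Example 7.1.1), as a bijection with inverse the action of the inverse substitution.
[cite: Hartshorne1977, II Example 7.1.1] -/
def substPointEquiv : ↥(projectiveSpace N k).left ≃ ↥(projectiveSpace N k).left where
  toFun p := (ProjectiveSpectrum.comapFun (ProjectiveSpace.substGraded τ hτ)
    (ProjectiveSpace.irrelevant_le_map_substGraded τ hτ τ' hτ' hinv) p : ProjectiveSpectrum 𝓐)
  invFun p := (ProjectiveSpectrum.comapFun (ProjectiveSpace.substGraded τ' hτ')
    (ProjectiveSpace.irrelevant_le_map_substGraded τ' hτ' τ hτ hinv') p : ProjectiveSpectrum 𝓐)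
  left_inv p := by
    apply ProjectiveSpectrum.ext
    apply HomogeneousSubmodule.ext
    ext x
    simp only [ProjectiveSpectrum.comapFun_asHomogeneousIdeal, HomogeneousIdeal.toIdeal_comap,
      Ideal.mem_comap]
    change aeval τ (aeval τ' x) ∈ _ ↔ _
    rw [hinv]
  right_inv p := by
    apply ProjectiveSpectrum.ext
    apply HomogeneousSubmodule.ext
    ext x
    simp only [ProjectiveSpectrum.comapFun_asHomogeneousIdeal, HomogeneousIdeal.toIdeal_comap,
      Ideal.mem_comap]
    change aeval τ' (aeval τ x) ∈ _ ↔ _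
    rw [hinv']

/-- The homogeneous prime of the transformed point is the preimage `σ_τ⁻¹(𝔭)`. [folklore] -/
theorem toIdeal_substPointEquiv_apply (p : ↥(projectiveSpace N k).left) :
    (ProjectiveSpectrum.asHomogeneousIdeal (𝒜 := 𝓐)
        (substPointEquiv τ hτ τ' hτ' hinv hinv' p)).toIdeal =
      Ideal.comap (aeval τ : MvPolynomial (Fin (N + 1)) k →ₐ[k] MvPolynomial (Fin (N + 1)) k)
        (ProjectiveSpectrum.asHomogeneousIdeal (𝒜 := 𝓐) p).toIdeal :=
  rfl

/-- The action of an invertible linear substitution on points is monotone for the specialisation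
order (preimages preserve inclusions of primes). [folklore] -/
theorem monotone_substPointEquiv : Monotone (substPointEquiv τ hτ τ' hτ' hinv hinv') := by
  intro a b hab
  rw [projectiveSpace_le_iff] at hab ⊢
  intro x hx
  exact hab hx

/-- **An invertible linear substitution acts on the points of `ℙᴺ_k` by an automorphism of the
specialisation order** (it underlies an automorphism of the scheme, Hartshorne II Example 7.1.1).
[cite: Hartshorne1977, II Example 7.1.1] -/
def substPointOrderIso : ↥(projectiveSpace N k).left ≃o ↥(projectiveSpace N k).left :=
  (substPointEquiv τ hτ τ' hτ' hinv hinv').toOrderIso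
    (monotone_substPointEquiv τ hτ τ' hτ' hinv hinv')
    (monotone_substPointEquiv τ' hτ' τ hτ hinv' hinv)

/-- `substPointOrderIso` is `substPointEquiv` on points (`rfl`). [folklore] -/
theorem substPointOrderIso_apply (p : ↥(projectiveSpace N k).left) :
    substPointOrderIso τ hτ τ' hτ' hinv hinv' p = substPointEquiv τ hτ τ' hτ' hinv hinv' p :=
  rfl

/-- Invertible linear substitutions preserve the dimension of points. [folklore] -/
theorem height_substPointEquiv (p : ↥(projectiveSpace N k).left) :
    height (substPointEquiv τ hτ τ' hτ' hinv hinv' p) = height p :=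
  height_orderIso (substPointOrderIso τ hτ τ' hτ' hinv hinv') p

/-- Invertible linear substitutions preserve the codimension of points. [folklore] -/
theorem coheight_substPointEquiv (p : ↥(projectiveSpace N k).left) :
    coheight (substPointEquiv τ hτ τ' hτ' hinv hinv' p) = coheight p :=
  coheight_orderIso (substPointOrderIso τ hτ τ' hτ' hinv hinv') p

end LinearChange

/-! ### Linear subspaces `V₊(L₁, …, L_t)` of `ℙᴺ_k`: generic point, dimension `N - t` -/

section LinearSubspaces

open _root_.MvPolynomial Literature.RingTheory.MvPolynomial

variable {k : Type u} [Field k] {N : ℕ}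

attribute [local instance] MvPolynomial.gradedAlgebra

local notation "𝓐" => MvPolynomial.homogeneousSubmodule (Fin (N + 1)) k

/-- The closure of a point of `ℙᴺ_k` is the zero locus of its homogeneous prime (Hartshorne II
Prop. 2.5, proof). [cite: Hartshorne1977, II Prop. 2.5] -/
theorem closure_singleton_eq_zeroLocus (p : ↥(projectiveSpace N k).left) :
    closure {p} = ProjectiveSpectrum.zeroLocus 𝓐
      (ProjectiveSpectrum.asHomogeneousIdeal (𝒜 := 𝓐) p : Set (MvPolynomial (Fin (N + 1)) k)) := by
  set P : ProjectiveSpectrum 𝓐 := p with hP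
  have key : closure ({P} : Set (ProjectiveSpectrum 𝓐)) =
      ProjectiveSpectrum.zeroLocus 𝓐 (P.asHomogeneousIdeal : Set (MvPolynomial (Fin (N + 1)) k)) := by
    ext z
    rw [← ProjectiveSpectrum.le_iff_mem_closure, ← ProjectiveSpectrum.as_ideal_le_as_ideal,
      ProjectiveSpectrum.mem_zeroLocus]
    rfl
  exact key

/-- In `ℙᴺ_k` (a `T₀` space) a point is determined by its closure. [folklore] -/
theorem eq_of_closure_singleton_eq {p q : ↥(projectiveSpace N k).left}
    (h : closure ({p} : Set ↥(projectiveSpace N k).left) = closure {q}) : p = q :=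
  ((specializes_iff_closure_subset.mpr h.ge).antisymm (specializes_iff_closure_subset.mpr h.le)).eq

/-- An ideal generated by a set is generated by the `k`-span of the set. [folklore] -/
theorem ideal_span_coe_span (S : Set (MvPolynomial (Fin (N + 1)) k)) :
    Ideal.span ((Submodule.span k S : Submodule k (MvPolynomial (Fin (N + 1)) k)) :
      Set (MvPolynomial (Fin (N + 1)) k)) = Ideal.span S := by
  apply le_antisymm
  · rw [Ideal.span_le]
    have h : Submodule.span k S ≤ (Ideal.span S).restrictScalars k :=
      Submodule.span_le.mpr Ideal.subset_span
    exact h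
  · exact Ideal.span_mono Submodule.subset_span

/-- The coordinate change attached to a basis `b` of `kᴺ⁺¹` pulls the coordinate ideal
`(xⱼ : j ∈ J)` back to the ideal generated by the linear forms `linForm (b j)`, `j ∈ J`.
[folklore] -/
theorem comap_coordChange_span_X_image (b : Module.Basis (Fin (N + 1)) k (Fin (N + 1) → k))
    (J : Finset (Fin (N + 1))) :
    Ideal.comap (coordChange b) (Ideal.span (X '' (J : Set (Fin (N + 1))))) =
      Ideal.span (linForm '' (b '' (J : Set (Fin (N + 1))))) := by
  have h1 : Ideal.comap (coordChange b) (Ideal.span (X '' (J : Set (Fin (N + 1))))) =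
      Ideal.comap (coordChangeEquiv b).toRingEquiv (Ideal.span (X '' (J : Set (Fin (N + 1))))) := by
    ext x
    simp only [Ideal.mem_comap]
    rfl
  rw [h1, ← Ideal.map_symm, Ideal.map_span, Set.image_image, Set.image_image]
  congr 1
  refine Set.image_congr' fun j ↦ ?_
  change coordChangeInv b (X j) = linForm (b j)
  rw [coordChangeInv, aeval_X]

/-- **Generic points of linear subspaces of `ℙᴺ_k`.** For `t ≤ N` linearly independent linear
forms `L₁, …, L_t` on `ℙᴺ_k` there is a point `ℓ` of the scheme `ℙᴺ_k` whose homogeneous prime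
is `(L₁, …, L_t)`, of dimension `height ℓ = N - t` and codimension `coheight ℓ = t`: after the
linear change of coordinates attached to a basis of `kᴺ⁺¹` adapted to the span of the `L_j`
(`Literature.RingTheory.MvPolynomial.exists_basis_adapted`, `coordChangeEquiv`) this is the
coordinate subspace `V₊(xⱼ : j ∈ J)`, `|J| = t` (`coordSubspacePoint`, `height_coordSubspacePoint`),
and invertible linear substitutions act on points by order isomorphisms (`substPointOrderIso`).
Hartshorne I Ex. 2.11 (linear varieties: `V₊` of `t` independent linear forms has dimension
`N - t`), II Example 7.1.1 (projective linear transformations). [cite: Hartshorne1977, I Ex. 2.11] -/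
theorem exists_point_of_linearIndependent {t : ℕ} (L : Fin t → MvPolynomial (Fin (N + 1)) k)
    (hL : LinearIndependent k L) (hhom : ∀ j, (L j).IsHomogeneous 1) (ht : t ≤ N) :
    ∃ ℓ : ↥(projectiveSpace N k).left,
      (ProjectiveSpectrum.asHomogeneousIdeal (𝒜 := 𝓐) ℓ).toIdeal = Ideal.span (Set.range L) ∧
        height ℓ = ((N - t : ℕ) : ℕ∞) ∧ coheight ℓ = (t : ℕ∞) := by
  classical
  -- the span of the `L_j` and its coefficient vectors
  set T : Submodule k (MvPolynomial (Fin (N + 1)) k) := Submodule.span k (Set.range L) with hT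
  have hT1 : T ≤ homogeneousSubmodule (Fin (N + 1)) k 1 :=
    Submodule.span_le.mpr (by
      rintro _ ⟨j, rfl⟩
      exact (mem_homogeneousSubmodule _ _).mpr (hhom j))
  set P : Submodule k (Fin (N + 1) → k) := T.comap linForm with hP
  have hPT : P.map linForm = T := map_comap_linForm hT1
  -- a basis of `kᴺ⁺¹` adapted to `P`
  obtain ⟨b, J, -, hJ, -⟩ := exists_basis_adapted P P
  have hcardJ : J.card = t := by
    have h1 : Module.finrank k P = t := by
      rw [LinearEquiv.finrank_eq (Submodule.equivMapOfInjective linForm linForm_injective P),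
        hPT, hT, finrank_span_eq_card hL, Fintype.card_fin]
    have h2 : Module.finrank k (Submodule.span k (b '' (J : Set (Fin (N + 1))))) = J.card := by
      rw [← Finset.coe_image, finrank_span_finset_eq_card,
        Finset.card_image_of_injective _ b.injective]
      rw [Finset.coe_image]
      exact b.linearIndependent.linearIndepOn_id.mono (Set.image_subset_range _ _)
    rw [hJ, h1] at h2
    exact h2.symm
  have hJne : J ≠ Finset.univ := by
    intro h
    rw [h, Finset.card_univ, Fintype.card_fin] at hcardJ
    omega
  -- the invertible linear substitution `coordChange b`
  set τ : Fin (N + 1) → MvPolynomial (Fin (N + 1)) k :=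
    fun i ↦ linForm (⇑(b.repr (Pi.single i 1))) with hτ_def
  set τ' : Fin (N + 1) → MvPolynomial (Fin (N + 1)) k := fun j ↦ linForm (b j) with hτ'_def
  have hτ : ∀ j, (τ j).IsHomogeneous 1 := fun j ↦ isHomogeneous_linForm _
  have hτ' : ∀ j, (τ' j).IsHomogeneous 1 := fun j ↦ isHomogeneous_linForm _
  have hinv : ∀ p, aeval τ (aeval τ' p) = p := fun p ↦ (coordChangeEquiv b).apply_symm_apply p
  have hinv' : ∀ p, aeval τ' (aeval τ p) = p := fun p ↦ (coordChangeEquiv b).symm_apply_apply p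
  refine ⟨substPointEquiv τ hτ τ' hτ' hinv hinv' (coordSubspacePoint J hJne), ?_, ?_, ?_⟩
  · rw [toIdeal_substPointEquiv_apply, toIdeal_coordSubspacePoint]
    change Ideal.comap (coordChange b) _ = _
    rw [comap_coordChange_span_X_image, ← ideal_span_coe_span, ← Submodule.map_span, hJ, hPT, hT,
      ideal_span_coe_span]
  · rw [height_substPointEquiv, (height_coordSubspacePoint J hJne).1, hcardJ]
  · rw [coheight_substPointEquiv, (height_coordSubspacePoint J hJne).2, hcardJ]

end LinearSubspaces

end Literature.AlgebraicGeometry.Motives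

end
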